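import Summits.CriticalPhenomena.PercolationContinuityZ3.Theorems.PercNearOneGluingNoHeavyLowerTailThreePartitionCombBridge
import Summits.CriticalPhenomena.PercolationContinuityZ3.Theorems.PercNearOneGluingNoHeavyLowerTailThreePartitionTwistedPrincipal

/-!
# `NoHeavyLowerTail` (crux stmt-CriticalPhenomena-4575): COMB (tensor-Bernstein) POSITIVITY OF SAHI'S `E₃` WITH ONE PRINCIPAL-FILTER SLOT,
# EVERY FINITE CUBE — the glue through `…ThreePartitionCombBridge`

Support file (lane `prim-ineq-gen-4`, generation 15; `--supports stmt-CriticalPhenomena-4575`).  Pure proofs, no definitions, no `sorry`, standard axioms.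
THEOREM (`combPos_sahiE_three_principal`): for every finite `ι`, every `S ⊆ ι` and all up-sets `𝒱, 𝒲 ⊆ 𝒫(ι)`, the polynomial
`p ↦ E₃(μ_p; 1_{↑S}, 1_𝒱, 1_𝒲)` (`sahiE (bernoulliWeight p) 3`, `↑S = {T | S ⊆ T}` the principal filter / orthant event "all coordinates of `S` are open") is a
NONNEGATIVE combination of the degree-3 tensor-Bernstein basis (`CombPos`); in particular (`…SahiCombMasterFamily`) it is `≥ 0` for every product measure.  This is the
cube/coefficientwise form of prim-ineq-gen-4 g10's THEOREM F4 ("(★) with one principal slot, all d", there via Level-2 certificates), now kernel-checked: every coefficient is a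
twisted three-partition count of sections (bridge `combCoef3_eq_threePartNT`, prim-l12 P3), the sections `secFam j ↑S` of a principal filter are principal filters of `Act j` or empty
(`secFam_principal_eq / secFam_principal_eq_empty`), and twisted three-partition positivity with one principal slot is `…ThreePartitionTwistedPrincipal.threePartNT_principal_nonneg`
(this generation).  HONEST LABEL: one principal slot; Sahi's `C₃` / Kahn's conjecture for three general up-sets stays OPEN. [this work]
-/

noncomputable section

open scoped Classical symmDiff
open Finset

namespace Summit.CriticalPhenomena.PercolationContinuityZ3.Theorems.ThreePartition

open Literature.Combinatorics.Sahi2008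
open Literature.Probability.Percolation.DecisionTree (ind)
open SahiComb

variable {ι : Type} [Fintype ι]

/-- The twisted functional vanishes when the first family is empty. [this work] -/
theorem threePartNT_empty_left {α : Type*} [Fintype α] (τ : Set α) (𝒱 𝒲 : Set (Set α)) :
    threePartNT τ (∅ : Set (Set α)) 𝒱 𝒲 = 0 := by
  unfold threePartNT topT teeT deeT triT
  have h1 : tri (fun S₁ S₂ S₃ : Set α => S₃ ∆ τ ∈ (∅ : Set (Set α)) ∩ 𝒱 ∩ 𝒲) = 0 := tri_eq_zero fun _ _ _ h => h.1.1
  have h2 : tri (fun S₁ S₂ S₃ : Set α => S₁ ∆ τ ∈ (∅ : Set (Set α)) ∧ S₂ ∆ τ ∈ 𝒱 ∧ S₃ ∆ τ ∈ 𝒲) = 0 := tri_eq_zero fun _ _ _ h => h.1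
  have h3 : tri (fun S₁ S₂ S₃ : Set α => S₁ ∆ τ ∈ (∅ : Set (Set α)) ∧ S₃ ∆ τ ∈ 𝒱 ∩ 𝒲) = 0 := tri_eq_zero fun _ _ _ h => h.1
  have h4 : tri (fun S₁ S₂ S₃ : Set α => S₁ ∆ τ ∈ 𝒱 ∧ S₃ ∆ τ ∈ (∅ : Set (Set α)) ∩ 𝒲) = 0 := tri_eq_zero fun _ _ _ h => h.2.1
  have h5 : tri (fun S₁ S₂ S₃ : Set α => S₁ ∆ τ ∈ 𝒲 ∧ S₃ ∆ τ ∈ (∅ : Set (Set α)) ∩ 𝒱) = 0 := tri_eq_zero fun _ _ _ h => h.2.1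
  rw [h1, h2, h3, h4, h5]
  simp

omit [Fintype ι] in
/-- Sections of a principal filter along a profile are principal filters of the active coordinates, when every generator is active or fully open. [this work] -/
theorem secFam_principal_eq {j : ι → ℕ} (S : Set ι) (hS : ∀ s ∈ S, ¬ (j s = 1 ∨ j s = 2) → j s = 3) :
    secFam j {T : Set ι | S ⊆ T} = {T : Set (Act j) | {e : Act j | e.1 ∈ S} ⊆ T} := by
  ext T
  simp only [secFam, Set.mem_setOf_eq]
  constructor
  · intro h e he
    exact (val_mem_liftSet_iff e).1 (h he)
  · intro h s hs
    by_cases hj : j s = 1 ∨ j s = 2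
    · exact (mem_liftSet_iff hj).2 (h (show (⟨s, hj⟩ : Act j) ∈ {e : Act j | e.1 ∈ S} from hs))
    · exact (mem_liftSet_iff_of_not hj).2 (hS s hs hj)

omit [Fintype ι] in
/-- … and empty when some generator is closed in the profile (`j s = 0`). [this work] -/
theorem secFam_principal_eq_empty {j : ι → ℕ} (S : Set ι) (hS : ¬ ∀ s ∈ S, ¬ (j s = 1 ∨ j s = 2) → j s = 3) :
    secFam j {T : Set ι | S ⊆ T} = ∅ := by
  obtain ⟨s, hs⟩ := not_forall.mp hS
  obtain ⟨hsS, hs2⟩ := Classical.not_imp.mp hs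
  obtain ⟨hj, hj3⟩ := Classical.not_imp.mp hs2
  ext T
  simp only [secFam, Set.mem_setOf_eq, Set.mem_empty_iff_false, iff_false]
  intro h
  have := (mem_liftSet_iff_of_not hj).1 (h hsS)
  exact hj3 this

/-- **COMB POSITIVITY OF `E₃` WITH ONE PRINCIPAL (ORTHANT) SLOT, EVERY FINITE CUBE.**  For every `S ⊆ ι` and all up-sets `𝒱, 𝒲`, the polynomial
`p ↦ E₃(μ_p; 1_{{T | S ⊆ T}}, 1_𝒱, 1_𝒲)` has a nonnegative tensor-Bernstein (degree-3) representation. [this work] -/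
theorem combPos_sahiE_three_principal (S : Set ι) {𝒱 𝒲 : Set (Set ι)} (h𝒱 : IsUpperSet 𝒱) (h𝒲 : IsUpperSet 𝒲) :
    CombPos (fun _ : ι => 3) (fun p => sahiE (bernoulliWeight p) 3 ![ind {T : Set ι | S ⊆ T}, ind 𝒱, ind 𝒲]) := by
  refine combPos_sahiE_three_of_combCoef3_nonneg fun j => ?_
  by_cases hj : ∀ e, j e ≤ 3
  · rw [combCoef3_eq_threePartNT {T : Set ι | S ⊆ T} 𝒱 𝒲 hj]
    by_cases hS : ∀ s ∈ S, ¬ (j s = 1 ∨ j s = 2) → j s = 3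
    · rw [secFam_principal_eq S hS]
      exact_mod_cast threePartNT_principal_nonneg (twist j) {e : Act j | e.1 ∈ S}
        (isUpperSet_secFam j h𝒱) (isUpperSet_secFam j h𝒲)
    · rw [secFam_principal_eq_empty S hS, threePartNT_empty_left]
      simp
  · rw [combCoef3_eq_zero_of_not_le _ _ _ hj]

end Summit.CriticalPhenomena.PercolationContinuityZ3.Theorems.ThreePartition
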